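import Summits.AtomisticToContinuum.Crystallization.Theorems.ChartedZeroExcessLayeredLatticeLiouvilleUU

/-!
# Zero-excess layered lattice Liouville — part UV (lens-2 g57, node «TailCert» 1/2): tools for (T) `TailDominationCert`.

Configuration-free lattice analysis on the index group `Cell 2 × ℤ` feeding the proof of (T) (part R, VERBATIM; proved in part UW):
* UV.1 `norm_forceConst_le` — `‖forceConst e‖ ≤ 38·|e|⁻⁸` for `|e| ≥ 9/10` (the tree's `ExcessDecayLiouville.norm_forceConst_le`, proof mirrored
  verbatim for part B's mirrored `forceConst`; DEDUP HOOK as in part B);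
* UV.2 the index sup-norm `idxNorm`, `idxNorm (Y - X) ≤ dist X Y`, the boxes `idxBox r` (`card = (2r+1)³`) and the SHELL SUM
  `Σ_{v ∈ V} N(v)⁻⁷·N(v)² ≤ 54` for every finite `V` (fibres of `idxNorm` + `sum_Ioo_inv_sq_le`);
* UV.3 translate increments `dispSq φ t = Σᶠ_U ‖φ(U+t) − φ(U)‖²` of a finitely supported field and the PATH-FREE DISCRETE POINCARÉ INEQUALITY
  `dispSq φ ((k+1)•s) ≤ (k+1)²·dispSq φ s` (from the pointwise identity `(m+1)‖A‖² + m(m+1)‖B‖² − m‖A+B‖² = ‖A − m•B‖² ≥ 0`, summed and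
  telescoped by induction), `dispSq φ (−t) = dispSq φ t`, and `dispSq φ A ≤ nnFormZ φ` for a unit step `A` (the axis decomposition and (T) itself follow in part UW).
* UV.4 `dispSq φ v ≤ 10·N(v)²·nnFormZ φ` (axis decomposition `v = v₁•A₁ + v₂•A₂ + v₃•A₃`).
[giaquinta1984 Ch. III §2 (difference quotients), folklore].  No statement of the column is re-typed here; `IsTameIndexing` is not used.
-/

noncomputable section

open scoped BigOperators InnerProductSpace RealInnerProductSpace
open MeasureTheory Set Metric Filter Topology
open Summit.AtomisticToContinuum.Crystallization.Theorems.ChartedPlanarOrderRigidityDoor (E3 IsNash atomsIn)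
open Summit.AtomisticToContinuum.Crystallization.Theorems.ChartedPlanarOrderDensityDichotomy (μS IsSep nK nK_nonneg)
open Summit.AtomisticToContinuum.Crystallization.Theorems.ChartedPlanarOrderDoorLayered (Layered layeredHom_eq_layered)

namespace Summit.AtomisticToContinuum.Crystallization.Theorems.ChartedZeroExcessLayeredLatticeLiouville

section TailCertTools

/-! ### UV.1  Size of the bond force-constant operator -/

-- UV.1 `norm_forceConst_le` is the tree's `ExcessDecayLiouville.norm_forceConst_le` (identical `forceConst` body; used from there in UW).

/-! ### UV.2  The index sup-norm, index boxes and the shell sum -/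

/-- the index sup-norm `N(v) = max(|v₁|, |v₂|, |v₃|)` on `Cell 2 × ℤ`. [this file, g57] -/
def idxNorm (v : Cell 2 × ℤ) : ℕ := max (max (v.1 0).natAbs (v.1 1).natAbs) v.2.natAbs

/-- Auxiliary step (`natAbs fst le idxNorm`). [formal bookkeeping] -/
theorem natAbs_fst_le_idxNorm (v : Cell 2 × ℤ) : ∀ j : Fin 2, (v.1 j).natAbs ≤ idxNorm v :=
  Fin.forall_fin_two.mpr ⟨le_max_of_le_left (le_max_left _ _), le_max_of_le_left (le_max_right _ _)⟩

/-- Auxiliary step (`natAbs snd le idxNorm`). [formal bookkeeping] -/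
theorem natAbs_snd_le_idxNorm (v : Cell 2 × ℤ) : v.2.natAbs ≤ idxNorm v := le_max_right _ _

/-- `N(v) ≥ 1` for `v ≠ 0`. -/
theorem idxNorm_pos {v : Cell 2 × ℤ} (hv : v ≠ 0) : 1 ≤ idxNorm v := by
  by_contra h
  have h0 : idxNorm v = 0 := by omega
  have e0 : v.1 0 = 0 := Int.natAbs_eq_zero.mp (Nat.eq_zero_of_le_zero (h0 ▸ natAbs_fst_le_idxNorm v 0))
  have e1 : v.1 1 = 0 := Int.natAbs_eq_zero.mp (Nat.eq_zero_of_le_zero (h0 ▸ natAbs_fst_le_idxNorm v 1))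
  have e2 : v.2 = 0 := Int.natAbs_eq_zero.mp (Nat.eq_zero_of_le_zero (h0 ▸ natAbs_snd_le_idxNorm v))
  exact hv (Prod.ext (funext (Fin.forall_fin_two.mpr ⟨e0, e1⟩)) e2)

/-- the index sup-norm of a displacement is at most the index distance (`Cell 2 × ℤ` carries the sup metric). -/
theorem idxNorm_le_dist (X Y : Cell 2 × ℤ) : (idxNorm (Y - X) : ℝ) ≤ dist X Y := by
  have hc : ∀ j : Fin 2, (((Y - X).1 j).natAbs : ℝ) ≤ dist X Y := fun j => by
    rw [Nat.cast_natAbs, Int.cast_abs, Prod.fst_sub, Pi.sub_apply, Int.cast_sub, abs_sub_comm, ← Int.dist_eq]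
    calc dist (X.1 j) (Y.1 j) ≤ dist X.1 Y.1 := dist_le_pi_dist X.1 Y.1 j
      _ ≤ dist X Y := by rw [Prod.dist_eq]; exact le_max_left _ _
  have h2 : (((Y - X).2).natAbs : ℝ) ≤ dist X Y := by
    rw [Nat.cast_natAbs, Int.cast_abs, Prod.snd_sub, Int.cast_sub, abs_sub_comm, ← Int.dist_eq, Prod.dist_eq]
    exact le_max_right _ _
  unfold idxNorm
  rw [Nat.cast_max, Nat.cast_max]
  exact max_le (max_le (hc 0) (hc 1)) h2

/-- the index box `{v : N(v) ≤ r}` as a finset. [this file, g57] -/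
def idxBox (r : ℕ) : Finset (Cell 2 × ℤ) :=
  (Fintype.piFinset fun _ : Fin 2 => Finset.Icc (-(r : ℤ)) r) ×ˢ Finset.Icc (-(r : ℤ)) r

/-- Auxiliary step (`mem idxBox`). [formal bookkeeping] -/
theorem mem_idxBox {r : ℕ} {v : Cell 2 × ℤ} (hv : idxNorm v ≤ r) : v ∈ idxBox r := by
  have key : ∀ z : ℤ, z.natAbs ≤ r → z ∈ Finset.Icc (-(r : ℤ)) r := fun z hz => by
    rw [Finset.mem_Icc]; omega
  exact Finset.mem_product.mpr ⟨Fintype.mem_piFinset.mpr fun j => key _ ((natAbs_fst_le_idxNorm v j).trans hv),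
    key _ ((natAbs_snd_le_idxNorm v).trans hv)⟩

/-- Auxiliary step (`card idxBox`). [formal bookkeeping] -/
theorem card_idxBox (r : ℕ) : (idxBox r).card = (2 * r + 1) ^ 3 := by
  have h1 : (Finset.Icc (-(r : ℤ)) r).card = 2 * r + 1 := by
    rw [Int.card_Icc]; omega
  rw [idxBox, Finset.card_product, Fintype.card_piFinset, Finset.prod_const, Finset.card_univ, Fintype.card_fin, h1]
  ring

/-- fibres of the index sup-norm have at most `(2r+1)³` points. -/
theorem card_filter_idxNorm_le (V : Finset (Cell 2 × ℤ)) (r : ℕ) :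
    ((V.filter fun v => idxNorm v = r).card : ℝ) ≤ (2 * (r : ℝ) + 1) ^ 3 := by
  have h := Finset.card_le_card (show (V.filter fun v => idxNorm v = r) ⊆ idxBox r from
    fun v hv => mem_idxBox (Finset.mem_filter.mp hv).2.le)
  rw [card_idxBox] at h
  exact_mod_cast h

/-- the shell weight `(2r+1)³ · r⁻⁷ · r² ≤ 27 · r⁻²` (`r : ℕ`; both sides vanish at `r = 0`). -/
theorem shell_weight_le (r : ℕ) :
    (2 * (r : ℝ) + 1) ^ 3 * ((((r : ℝ)) ^ 7)⁻¹ * (r : ℝ) ^ 2) ≤ 27 * ((r : ℝ) ^ 2)⁻¹ := by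
  rcases Nat.eq_zero_or_pos r with hr | hr
  · subst hr; simp
  · have hr0 : (0 : ℝ) < r := by exact_mod_cast hr
    have hr1 : (1 : ℝ) ≤ r := by exact_mod_cast hr
    have e1 : (((r : ℝ)) ^ 7)⁻¹ * (r : ℝ) ^ 2 = ((r : ℝ) ^ 5)⁻¹ := by
      rw [show (r : ℝ) ^ 7 = (r : ℝ) ^ 5 * (r : ℝ) ^ 2 by ring, mul_inv, mul_assoc,
        inv_mul_cancel₀ (by positivity), mul_one]
    have e2 : ((r : ℝ) ^ 2)⁻¹ = (r : ℝ) ^ 3 * ((r : ℝ) ^ 5)⁻¹ := by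
      rw [show (r : ℝ) ^ 5 = (r : ℝ) ^ 3 * (r : ℝ) ^ 2 by ring, mul_inv, ← mul_assoc,
        mul_inv_cancel₀ (by positivity), one_mul]
    rw [e1, e2, ← mul_assoc]
    refine mul_le_mul_of_nonneg_right ?_ (by positivity)
    calc (2 * (r : ℝ) + 1) ^ 3 ≤ (3 * (r : ℝ)) ^ 3 := pow_le_pow_left₀ (by positivity) (by linarith) 3
      _ = 27 * (r : ℝ) ^ 3 := by ring

/-- ★ SHELL SUM: `Σ_{v ∈ V} N(v)⁻⁷ · N(v)² ≤ 54` for every finite `V ⊆ Cell 2 × ℤ`. [folklore; this file, g57] -/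
theorem sum_idxWeight_le (V : Finset (Cell 2 × ℤ)) :
    ∑ v ∈ V, (((idxNorm v : ℝ)) ^ 7)⁻¹ * (idxNorm v : ℝ) ^ 2 ≤ 54 := by
  classical
  set g : ℕ → ℝ := fun r => (((r : ℝ)) ^ 7)⁻¹ * (r : ℝ) ^ 2 with hg
  have hg0 : ∀ r, 0 ≤ g r := fun r => by rw [hg]; positivity
  set A := V.image idxNorm with hA
  have h1 : ∑ v ∈ V, g (idxNorm v) = ∑ r ∈ A, ∑ v ∈ V with idxNorm v = r, g (idxNorm v) :=
    (Finset.sum_fiberwise_of_maps_to (fun v hv => Finset.mem_image_of_mem idxNorm hv) _).symm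
  have h2 : ∀ r, ∑ v ∈ V with idxNorm v = r, g (idxNorm v) ≤ 27 * ((r : ℝ) ^ 2)⁻¹ := by
    intro r
    have hc : ∑ v ∈ V with idxNorm v = r, g (idxNorm v) = ((V.filter fun v => idxNorm v = r).card : ℝ) * g r := by
      rw [Finset.sum_congr rfl fun v hv => by rw [(Finset.mem_filter.mp hv).2], Finset.sum_const, nsmul_eq_mul]
    rw [hc]
    calc ((V.filter fun v => idxNorm v = r).card : ℝ) * g r ≤ (2 * (r : ℝ) + 1) ^ 3 * g r :=
          mul_le_mul_of_nonneg_right (card_filter_idxNorm_le V r) (hg0 r)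
      _ ≤ 27 * ((r : ℝ) ^ 2)⁻¹ := shell_weight_le r
  set R := A.sup id with hR
  have hsub : A.erase 0 ⊆ Finset.Ioo 0 (R + 1) := fun r hr => by
    rw [Finset.mem_erase] at hr
    rw [Finset.mem_Ioo]
    exact ⟨Nat.pos_of_ne_zero hr.1, Nat.lt_succ_of_le (Finset.le_sup (f := id) hr.2)⟩
  have hz : (27 : ℝ) * (((0 : ℕ) : ℝ) ^ 2)⁻¹ = 0 := by simp
  have hIoo : ∑ i ∈ Finset.Ioo 0 (R + 1), ((i : ℝ) ^ 2)⁻¹ ≤ 2 := by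
    have := sum_Ioo_inv_sq_le (α := ℝ) 0 (R + 1)
    norm_num at this
    exact this
  show ∑ v ∈ V, g (idxNorm v) ≤ 54
  calc ∑ v ∈ V, g (idxNorm v) = ∑ r ∈ A, ∑ v ∈ V with idxNorm v = r, g (idxNorm v) := h1
    _ ≤ ∑ r ∈ A, 27 * ((r : ℝ) ^ 2)⁻¹ := Finset.sum_le_sum fun r _ => h2 r
    _ = ∑ r ∈ A.erase 0, 27 * ((r : ℝ) ^ 2)⁻¹ := (Finset.sum_erase A hz).symm
    _ ≤ ∑ r ∈ Finset.Ioo 0 (R + 1), 27 * ((r : ℝ) ^ 2)⁻¹ :=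
        Finset.sum_le_sum_of_subset_of_nonneg hsub fun r _ _ => by positivity
    _ = 27 * ∑ i ∈ Finset.Ioo 0 (R + 1), ((i : ℝ) ^ 2)⁻¹ := (Finset.mul_sum _ _ _).symm
    _ ≤ 27 * 2 := by gcongr
    _ = 54 := by norm_num

/-! ### UV.3  Translate increments and the path-free discrete Poincaré inequality -/

variable {φ : Cell 2 → ℤ → E3} {S : Finset (Cell 2 × ℤ)}

/-- the `t`-translate increment family `U ↦ ‖φ(U + t) − φ(U)‖²`. [this file, g57] -/
def dispSqFam (φ : Cell 2 → ℤ → E3) (t U : Cell 2 × ℤ) : ℝ := ‖φ (U + t).1 (U + t).2 - φ U.1 U.2‖ ^ 2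

/-- the `t`-translate increment `dispSq φ t = Σᶠ_U ‖φ(U + t) − φ(U)‖²`. [this file, g57] -/
def dispSq (φ : Cell 2 → ℤ → E3) (t : Cell 2 × ℤ) : ℝ := ∑ᶠ U, dispSqFam φ t U

/-- Auxiliary step (`dispSqFam nonneg`). [formal bookkeeping] -/
theorem dispSqFam_nonneg (φ : Cell 2 → ℤ → E3) (t U : Cell 2 × ℤ) : 0 ≤ dispSqFam φ t U := sq_nonneg _

/-- Auxiliary step (`dispSq nonneg`). [formal bookkeeping] -/
theorem dispSq_nonneg (φ : Cell 2 → ℤ → E3) (t : Cell 2 × ℤ) : 0 ≤ dispSq φ t :=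
  finsum_nonneg fun U => dispSqFam_nonneg φ t U

/-- Auxiliary step (`dispSqFam sub fst`). [formal bookkeeping] -/
theorem dispSqFam_sub_fst (φ : Cell 2 → ℤ → E3) (x : (Cell 2 × ℤ) × (Cell 2 × ℤ)) :
    dispSqFam φ (x.2 - x.1) x.1 = ‖φ x.2.1 x.2.2 - φ x.1.1 x.1.2‖ ^ 2 := by
  unfold dispSqFam; rw [add_sub_cancel]

/-- with `φ = 0` off the finset `S`, `dispSqFam φ t` vanishes off `S ∪ (S − t)`. -/
theorem dispSqFam_eq_zero (hS : ∀ U : Cell 2 × ℤ, U ∉ S → φ U.1 U.2 = 0) (t : Cell 2 × ℤ) :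
    ∀ U : Cell 2 × ℤ, U ∉ S ∪ S.image (fun V => V - t) → dispSqFam φ t U = 0 := by
  intro U hU
  rw [Finset.mem_union, not_or] at hU
  have h1 : φ U.1 U.2 = 0 := hS U hU.1
  have h2 : φ (U + t).1 (U + t).2 = 0 :=
    hS (U + t) fun h => hU.2 (Finset.mem_image.mpr ⟨U + t, h, add_sub_cancel_right U t⟩)
  unfold dispSqFam
  rw [h1, h2, sub_zero, norm_zero]
  norm_num

/-- Auxiliary step (`support dispSqFam shift finite`). [formal bookkeeping] -/
theorem support_dispSqFam_shift_finite (hS : ∀ U : Cell 2 × ℤ, U ∉ S → φ U.1 U.2 = 0) (t t' : Cell 2 × ℤ) :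
    (Function.support fun U => dispSqFam φ t (U + t')).Finite := by
  classical
  refine ((S ∪ S.image (fun V => V - t)).image (fun V => V - t')).finite_toSet.subset fun U hU => ?_
  by_contra h
  refine hU (dispSqFam_eq_zero hS t (U + t') fun h' => h ?_)
  exact Finset.mem_coe.mpr (Finset.mem_image.mpr ⟨U + t', h', add_sub_cancel_right U t'⟩)

/-- Auxiliary step (`support dispSqFam finite`). [formal bookkeeping] -/
theorem support_dispSqFam_finite (hS : ∀ U : Cell 2 × ℤ, U ∉ S → φ U.1 U.2 = 0) (t : Cell 2 × ℤ) :
    (Function.support (dispSqFam φ t)).Finite := by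
  have h := support_dispSqFam_shift_finite hS t 0
  simp only [add_zero] at h
  exact h

/-- comparison of finite sums: `f ≤ g`, `0 ≤ f`, `g` finitely supported. -/
theorem finsum_le_finsum_of_le {ι : Type*} {f g : ι → ℝ} (hfg : ∀ i, f i ≤ g i) (hf : ∀ i, 0 ≤ f i)
    (hg : (Function.support g).Finite) : ∑ᶠ i, f i ≤ ∑ᶠ i, g i := by
  have hfs : Function.support f ⊆ ↑hg.toFinset := fun i hi => by
    rw [Set.Finite.coe_toFinset]
    exact fun h0 => hi (le_antisymm ((hfg i).trans h0.le) (hf i))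
  have hgs : Function.support g ⊆ ↑hg.toFinset := fun i hi => by
    rw [Set.Finite.coe_toFinset]; exact hi
  rw [finsum_eq_sum_of_support_subset f hfs, finsum_eq_sum_of_support_subset g hgs]
  exact Finset.sum_le_sum fun i _ => hfg i

/-- a finite partial sum of a non-negative finitely supported family is at most its finite sum. -/
theorem sum_le_finsum_of_nonneg {ι : Type*} {f : ι → ℝ} (A : Finset ι) (hf : ∀ i, 0 ≤ f i)
    (hfin : (Function.support f).Finite) : ∑ i ∈ A, f i ≤ ∑ᶠ i, f i := by
  classical
  have hs : Function.support f ⊆ ↑(A ∪ hfin.toFinset) := fun i hi => by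
    rw [Finset.coe_union, Set.Finite.coe_toFinset]; exact Or.inr hi
  rw [finsum_eq_sum_of_support_subset f hs]
  exact Finset.sum_le_sum_of_subset_of_nonneg Finset.subset_union_left fun i _ _ => hf i

/-- the pointwise identity behind the Poincaré step: `(m+1)‖A‖² + m(m+1)‖B‖² − m‖A + B‖² = ‖A − m•B‖² ≥ 0`. -/
theorem weighted_norm_add_sq_le (A B : E3) (m : ℝ) :
    m * ‖A + B‖ ^ 2 ≤ (m + 1) * ‖A‖ ^ 2 + m * (m + 1) * ‖B‖ ^ 2 := by
  have h0 : 0 ≤ ‖A - m • B‖ ^ 2 := sq_nonneg _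
  rw [norm_sub_sq_real, inner_smul_right, norm_smul, Real.norm_eq_abs, mul_pow, sq_abs] at h0
  rw [norm_add_sq_real]
  nlinarith [h0]

/-- ★ the POINCARÉ STEP: `m · dispSq φ (t + t') ≤ (m+1) · dispSq φ t + m(m+1) · dispSq φ t'` (`m ≥ 0`). [this file, g57] -/
theorem dispSq_add_le (hS : ∀ U : Cell 2 × ℤ, U ∉ S → φ U.1 U.2 = 0) (t t' : Cell 2 × ℤ) {m : ℝ} (hm : 0 ≤ m) :
    m * dispSq φ (t + t') ≤ (m + 1) * dispSq φ t + m * (m + 1) * dispSq φ t' := by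
  have hpt : ∀ U : Cell 2 × ℤ, m * dispSqFam φ (t + t') U ≤
      (m + 1) * dispSqFam φ t (U + t') + m * (m + 1) * dispSqFam φ t' U := by
    intro U
    have hsplit : φ (U + (t + t')).1 (U + (t + t')).2 - φ U.1 U.2 =
        (φ (U + t' + t).1 (U + t' + t).2 - φ (U + t').1 (U + t').2) + (φ (U + t').1 (U + t').2 - φ U.1 U.2) := by
      rw [show U + (t + t') = U + t' + t by abel]
      abel
    unfold dispSqFam
    rw [hsplit]
    exact weighted_norm_add_sq_le _ _ m
  have hf1 : (Function.support fun U => (m + 1) * dispSqFam φ t (U + t')).Finite :=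
    (support_dispSqFam_shift_finite hS t t').subset (Function.support_mul_subset_right _ _)
  have hf2 : (Function.support fun U => m * (m + 1) * dispSqFam φ t' U).Finite :=
    (support_dispSqFam_finite hS t').subset (Function.support_mul_subset_right _ _)
  have hre : ∑ᶠ U : Cell 2 × ℤ, dispSqFam φ t (U + t') = dispSq φ t := finsum_comp_equiv (Equiv.addRight t')
  calc m * dispSq φ (t + t') = ∑ᶠ U, m * dispSqFam φ (t + t') U := mul_finsum _ _
    _ ≤ ∑ᶠ U, ((m + 1) * dispSqFam φ t (U + t') + m * (m + 1) * dispSqFam φ t' U) :=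
        finsum_le_finsum_of_le hpt (fun U => mul_nonneg hm (dispSqFam_nonneg φ _ U)) ((hf1.union hf2).subset
          (Function.support_add _ _))
    _ = ∑ᶠ U, (m + 1) * dispSqFam φ t (U + t') + ∑ᶠ U, m * (m + 1) * dispSqFam φ t' U := finsum_add_distrib hf1 hf2
    _ = (m + 1) * dispSq φ t + m * (m + 1) * dispSq φ t' := by
        rw [← mul_finsum, ← mul_finsum, hre]; rfl

/-- Auxiliary step (`dispSq zero`). [formal bookkeeping] -/
theorem dispSq_zero (φ : Cell 2 → ℤ → E3) : dispSq φ 0 = 0 := by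
  have h : ∀ U : Cell 2 × ℤ, dispSqFam φ 0 U = 0 := fun U => by
    unfold dispSqFam
    rw [add_zero, sub_self, norm_zero]
    norm_num
  unfold dispSq
  exact (finsum_congr h).trans finsum_zero

/-- ★ PATH-FREE DISCRETE POINCARÉ: `dispSq φ (k • s) ≤ k² · dispSq φ s`. [giaquinta1984 Ch. III §2; this file, g57] -/
theorem dispSq_nsmul_le (hS : ∀ U : Cell 2 × ℤ, U ∉ S → φ U.1 U.2 = 0) (s : Cell 2 × ℤ) :
    ∀ k : ℕ, dispSq φ (k • s) ≤ (k : ℝ) ^ 2 * dispSq φ s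
  | 0 => by rw [zero_nsmul, dispSq_zero]; simp
  | k + 1 => by
      rcases Nat.eq_zero_or_pos k with hk | hk
      · subst hk; simp
      · have ih := dispSq_nsmul_le hS s k
        have hkpos : (0 : ℝ) < k := by exact_mod_cast hk
        have h := dispSq_add_le hS (k • s) s hkpos.le
        rw [← succ_nsmul] at h
        have h' : (k : ℝ) * dispSq φ ((k + 1) • s) ≤ (k : ℝ) * ((((k + 1 : ℕ)) : ℝ) ^ 2 * dispSq φ s) :=
          calc (k : ℝ) * dispSq φ ((k + 1) • s) ≤ ((k : ℝ) + 1) * dispSq φ (k • s) + k * (k + 1) * dispSq φ s := h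
            _ ≤ ((k : ℝ) + 1) * ((k : ℝ) ^ 2 * dispSq φ s) + k * (k + 1) * dispSq φ s := by
                have : ((k : ℝ) + 1) * dispSq φ (k • s) ≤ ((k : ℝ) + 1) * ((k : ℝ) ^ 2 * dispSq φ s) :=
                  mul_le_mul_of_nonneg_left ih (by positivity)
                linarith
            _ = (k : ℝ) * ((((k + 1 : ℕ)) : ℝ) ^ 2 * dispSq φ s) := by push_cast; ring
        exact le_of_mul_le_mul_left h' hkpos

/-- Auxiliary step (`dispSq neg`). [formal bookkeeping] -/
theorem dispSq_neg (φ : Cell 2 → ℤ → E3) (t : Cell 2 × ℤ) : dispSq φ (-t) = dispSq φ t := by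
  unfold dispSq
  rw [← finsum_comp_equiv (Equiv.addRight t) (f := dispSqFam φ (-t))]
  refine finsum_congr fun U => ?_
  show dispSqFam φ (-t) (U + t) = dispSqFam φ t U
  unfold dispSqFam
  rw [add_neg_cancel_right, norm_sub_rev]

/-- Auxiliary step (`dispSq zsmul le`). [formal bookkeeping] -/
theorem dispSq_zsmul_le (hS : ∀ U : Cell 2 × ℤ, U ∉ S → φ U.1 U.2 = 0) (s : Cell 2 × ℤ) (z : ℤ) :
    dispSq φ (z • s) ≤ (z : ℝ) ^ 2 * dispSq φ s := by
  have hcast : (((z.natAbs : ℕ)) : ℝ) ^ 2 = (z : ℝ) ^ 2 := by rw [Nat.cast_natAbs, Int.cast_abs, sq_abs]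
  rcases Int.natAbs_eq z with hz | hz
  · have h := dispSq_nsmul_le hS s z.natAbs
    rw [← natCast_zsmul, ← hz, hcast] at h
    exact h
  · have h := dispSq_nsmul_le hS s z.natAbs
    rw [← natCast_zsmul, hcast, ← dispSq_neg, ← neg_zsmul, ← hz] at h
    exact h

/-- the increment along a UNIT STEP is dominated by the nearest-neighbour form. -/
theorem dispSq_le_nnFormZ (hS : ∀ U : Cell 2 × ℤ, U ∉ S → φ U.1 U.2 = 0) {A : Cell 2 × ℤ}
    (hA : ∀ U : Cell 2 × ℤ, dist U (U + A) ≤ 1) : dispSq φ A ≤ nnFormZ φ := by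
  classical
  have hsupp : Function.support (dispSqFam φ A) ⊆ ↑(S ∪ S.image (fun V => V - A)) := fun U hU => by
    by_contra h
    exact hU (dispSqFam_eq_zero hS A U fun h' => h (Finset.mem_coe.mpr h'))
  have h1 : dispSq φ A = ∑ U ∈ S ∪ S.image (fun V => V - A), dispSqFam φ A U :=
    finsum_eq_sum_of_support_subset _ hsupp
  have hι : Set.InjOn (fun U : Cell 2 × ℤ => ((U, U + A) : (Cell 2 × ℤ) × (Cell 2 × ℤ)))
      ↑(S ∪ S.image (fun V => V - A)) := fun U _ V _ h => (Prod.ext_iff.mp h).1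
  have h2 : ∑ U ∈ S ∪ S.image (fun V => V - A), dispSqFam φ A U =
      ∑ x ∈ (S ∪ S.image (fun V => V - A)).image (fun U => (U, U + A)), nnFam φ x := by
    rw [Finset.sum_image hι]
    refine Finset.sum_congr rfl fun U _ => ?_
    unfold dispSqFam nnFam
    dsimp only
    rw [if_pos (hA U)]
  have h3 : ∑ x ∈ (S ∪ S.image (fun V => V - A)).image (fun U => (U, U + A)), nnFam φ x ≤
      ∑ x ∈ (S ∪ S.image (fun V => V - A)).image (fun U => (U, U + A)) ∪ nbSet S ×ˢ nbSet S, nnFam φ x :=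
    Finset.sum_le_sum_of_subset_of_nonneg Finset.subset_union_left fun x _ _ => nnFam_nonneg φ x
  have h4 : ∑ x ∈ nbSet S ×ˢ nbSet S, nnFam φ x =
      ∑ x ∈ (S ∪ S.image (fun V => V - A)).image (fun U => (U, U + A)) ∪ nbSet S ×ˢ nbSet S, nnFam φ x := by
    refine Finset.sum_subset Finset.subset_union_right fun x _ hx => ?_
    by_contra hne
    exact hx (Finset.mem_coe.mp (support_nnFam_subset hS (Function.mem_support.mpr hne)))
  rw [h1, h2, nnFormZ_eq_sum hS, h4]
  exact h3

end TailCertTools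

end Summit.AtomisticToContinuum.Crystallization.Theorems.ChartedZeroExcessLayeredLatticeLiouville
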